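import Mathlib
import Summits.Ventures.PercRepro2.Defs
import Summits.Ventures.PercRepro2.Independence
import Summits.Ventures.PercRepro2.Harris
import Summits.Ventures.PercRepro2.Graph
import Summits.Ventures.PercRepro2.Events
import Summits.Ventures.PercRepro2.ZCZeroWeight
import Summits.Ventures.PercRepro2.ZCReroute
import Summits.Ventures.PercRepro2.ZCInsertP
import Summits.Ventures.PercRepro2.ZCOA3WGraph
import Summits.Ventures.PercRepro2.ZCA3OWGraph

/-!
# Theorems I and J for `p`-degree-two marks — the composable forms
(blind cell PercRepro2, mine-a g25; MINE-A.md §74.6)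

The graph instances `zc_oa3w_graph` (`o` between `a₃` and `w`) and `zc_a3ow_graph` (`a₃` between `o`
and `w`) assume that the degree-two mark has EXACTLY the two edges `f₁`, `f₂` in `ends`.  As in
`ZCInsertP` the hypothesis is weakened to «every other edge at the mark has weight `0`» by re-routing
the zero-weight edges into a loop at `a₁` (`ZCReroute.zc_expr_congr`), so that the two mirror
reductions compose with the leaf strips and the insertions E–H in the kernel.  One seat.
-/

namespace Summit.Ventures.PercRepro2

section InsertP2

variable {V : Type*} [DecidableEq V] [Fintype V] {E : Type*} [Fintype E] [DecidableEq E] {R : Type*}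
  [CommRing R] [LinearOrder R] [IsStrictOrderedRing R]

/-- **Theorem I, `p`-form**: `o` has the edges `f₁ = oa₃`, `f₂ = ow` and every other edge at `o` has
weight `0`. -/
theorem zc_oa3w_graph' {p : E → R} (hp : IsProbVec p) {ends : E → Sym2 V} {a₁ a₃ o w : V}
    {f₁ f₂ : E} (hf : f₁ ≠ f₂) (hends₁ : ends f₁ = s(o, a₃)) (hends₂ : ends f₂ = s(o, w))
    (hmark : ∀ e, o ∈ ends e → e = f₁ ∨ e = f₂ ∨ p e = 0) (ho1 : o ≠ a₁) (ho3 : o ≠ a₃)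
    {𝓔 : Set (Set V)} (h𝓔 : IsUpperSet 𝓔)
    (hZ₀ : let p' := Function.update (Function.update p f₁ 0) f₂ 0
      let e' := connEvent ends a₁ a₃
      let L' := connEvent ends a₁ w
      let U' := clusterInEvent ends a₁ 𝓔
      let γ' := connEvent ends a₃ w
      0 ≤ prob p' (e'ᶜ ∩ L'ᶜ ∩ γ'ᶜ) * (prob p' (U' ∩ (e' ∩ L')) - prob p' U' * prob p' (e' ∩ L'))
        - prob p' (e'ᶜ ∩ L'ᶜ ∩ γ') * (prob p' (U' ∩ (e' ∩ L'ᶜ)) - prob p' U' * prob p' (e' ∩ L'ᶜ)))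
    (hZ₁ : let p' := Function.update (Function.update p f₁ 0) f₂ 0
      let 𝓔' : Set (Set V) := {S | insert o S ∈ 𝓔}
      let e' := connEvent ends a₁ a₃
      let L' := connEvent ends a₁ w
      let U' := clusterInEvent ends a₁ 𝓔'
      let γ' := connEvent ends a₃ w
      0 ≤ prob p' (e'ᶜ ∩ L'ᶜ ∩ γ'ᶜ) * (prob p' (U' ∩ (e' ∩ L')) - prob p' U' * prob p' (e' ∩ L'))
        - prob p' (e'ᶜ ∩ L'ᶜ ∩ γ') * (prob p' (U' ∩ (e' ∩ L'ᶜ)) - prob p' U' * prob p' (e' ∩ L'ᶜ))) :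
    let e := connEvent ends a₁ a₃
    let L := connEvent ends a₁ o
    let U := clusterInEvent ends a₁ 𝓔
    let γ := connEvent ends a₃ o
    0 ≤ prob p (eᶜ ∩ Lᶜ ∩ γᶜ) * (prob p (U ∩ (e ∩ L)) - prob p U * prob p (e ∩ L))
      - prob p (eᶜ ∩ Lᶜ ∩ γ) * (prob p (U ∩ (e ∩ Lᶜ)) - prob p U * prob p (e ∩ Lᶜ)) := by
  intro e L U γ
  simp only at hZ₀ hZ₁
  classical
  set Z : Finset E := Finset.univ.filter (fun e => e ≠ f₁ ∧ e ≠ f₂ ∧ o ∈ ends e) with hZdef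
  have hZ0 : ∀ e ∈ Z, p e = 0 := by
    intro e he
    simp only [hZdef, Finset.mem_filter, Finset.mem_univ, true_and] at he
    rcases hmark e he.2.2 with h | h | h
    · exact absurd h he.1
    · exact absurd h he.2.1
    · exact h
  have hf1Z : f₁ ∉ Z := by simp [hZdef]
  have hf2Z : f₂ ∉ Z := by simp [hZdef]
  have hagree := reroute_agree ends Z a₁
  have hends₁' : (fun e => if e ∈ Z then s(a₁, a₁) else ends e) f₁ = s(o, a₃) := by
    simp only [hf1Z, if_false]; exact hends₁
  have hends₂' : (fun e => if e ∈ Z then s(a₁, a₁) else ends e) f₂ = s(o, w) := by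
    simp only [hf2Z, if_false]; exact hends₂
  have hmark' : ∀ e, o ∈ (fun e => if e ∈ Z then s(a₁, a₁) else ends e) e → e = f₁ ∨ e = f₂ := by
    intro e he
    by_cases heZ : e ∈ Z
    · simp only [heZ, if_true, Sym2.mem_iff, or_self] at he
      exact absurd he ho1
    · simp only [heZ, if_false] at he
      simp only [hZdef, Finset.mem_filter, Finset.mem_univ, true_and, not_and] at heZ
      by_cases h1 : e = f₁
      · exact Or.inl h1
      · exact Or.inr (by_contra fun h2 => absurd (heZ h1 h2) (fun h => h he))
  have hZ0' : ∀ e ∈ Z, Function.update (Function.update p f₁ 0) f₂ 0 e = 0 :=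
    fun e he => update_two_zero_of_zero p f₁ f₂ e (hZ0 e he)
  have hc₀ := zc_expr_congr (Function.update (Function.update p f₁ 0) f₂ 0) Z hZ0' hagree a₁ a₃ w 𝓔
  have hc₁ := zc_expr_congr (Function.update (Function.update p f₁ 0) f₂ 0) Z hZ0' hagree a₁ a₃ w
    {S | insert o S ∈ 𝓔}
  simp only at hc₀ hc₁
  have key := zc_oa3w_graph hp hf hends₁' hends₂' hmark' ho1 ho3 h𝓔 (hZ₀.trans_eq hc₀)
    (hZ₁.trans_eq hc₁)
  simp only at key
  have hc := zc_expr_congr p Z hZ0 hagree a₁ a₃ o 𝓔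
  simp only at hc
  exact key.trans_eq hc.symm

/-- **Theorem J, `p`-form**: `a₃` has the edges `f₁ = a₃o`, `f₂ = a₃w` and every other edge at `a₃` has
weight `0`. -/
theorem zc_a3ow_graph' {p : E → R} (hp : IsProbVec p) {ends : E → Sym2 V} {a₁ a₃ o w : V}
    {f₁ f₂ : E} (hf : f₁ ≠ f₂) (hends₁ : ends f₁ = s(a₃, o)) (hends₂ : ends f₂ = s(a₃, w))
    (hmark : ∀ e, a₃ ∈ ends e → e = f₁ ∨ e = f₂ ∨ p e = 0) (h31 : a₃ ≠ a₁) (h3o : a₃ ≠ o)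
    {𝓔 : Set (Set V)} (h𝓔 : IsUpperSet 𝓔)
    (hZ : let p' := Function.update (Function.update p f₁ 0) f₂ 0
      let 𝓔' : Set (Set V) := {S | insert a₃ S ∈ 𝓔}
      let e' := connEvent ends a₁ w
      let L' := connEvent ends a₁ o
      let U' := clusterInEvent ends a₁ 𝓔'
      let γ' := connEvent ends w o
      0 ≤ prob p' (e'ᶜ ∩ L'ᶜ ∩ γ'ᶜ) * (prob p' (U' ∩ (e' ∩ L')) - prob p' U' * prob p' (e' ∩ L'))
        - prob p' (e'ᶜ ∩ L'ᶜ ∩ γ') * (prob p' (U' ∩ (e' ∩ L'ᶜ)) - prob p' U' * prob p' (e' ∩ L'ᶜ))) :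
    let e := connEvent ends a₁ a₃
    let L := connEvent ends a₁ o
    let U := clusterInEvent ends a₁ 𝓔
    let γ := connEvent ends a₃ o
    0 ≤ prob p (eᶜ ∩ Lᶜ ∩ γᶜ) * (prob p (U ∩ (e ∩ L)) - prob p U * prob p (e ∩ L))
      - prob p (eᶜ ∩ Lᶜ ∩ γ) * (prob p (U ∩ (e ∩ Lᶜ)) - prob p U * prob p (e ∩ Lᶜ)) := by
  intro e L U γ
  simp only at hZ
  classical
  set Z : Finset E := Finset.univ.filter (fun e => e ≠ f₁ ∧ e ≠ f₂ ∧ a₃ ∈ ends e) with hZdef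
  have hZ0 : ∀ e ∈ Z, p e = 0 := by
    intro e he
    simp only [hZdef, Finset.mem_filter, Finset.mem_univ, true_and] at he
    rcases hmark e he.2.2 with h | h | h
    · exact absurd h he.1
    · exact absurd h he.2.1
    · exact h
  have hf1Z : f₁ ∉ Z := by simp [hZdef]
  have hf2Z : f₂ ∉ Z := by simp [hZdef]
  have hagree := reroute_agree ends Z a₁
  have hends₁' : (fun e => if e ∈ Z then s(a₁, a₁) else ends e) f₁ = s(a₃, o) := by
    simp only [hf1Z, if_false]; exact hends₁
  have hends₂' : (fun e => if e ∈ Z then s(a₁, a₁) else ends e) f₂ = s(a₃, w) := by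
    simp only [hf2Z, if_false]; exact hends₂
  have hmark' : ∀ e, a₃ ∈ (fun e => if e ∈ Z then s(a₁, a₁) else ends e) e → e = f₁ ∨ e = f₂ := by
    intro e he
    by_cases heZ : e ∈ Z
    · simp only [heZ, if_true, Sym2.mem_iff, or_self] at he
      exact absurd he h31
    · simp only [heZ, if_false] at he
      simp only [hZdef, Finset.mem_filter, Finset.mem_univ, true_and, not_and] at heZ
      by_cases h1 : e = f₁
      · exact Or.inl h1
      · exact Or.inr (by_contra fun h2 => absurd (heZ h1 h2) (fun h => h he))
  have hZ0' : ∀ e ∈ Z, Function.update (Function.update p f₁ 0) f₂ 0 e = 0 :=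
    fun e he => update_two_zero_of_zero p f₁ f₂ e (hZ0 e he)
  have hc₁ := zc_expr_congr (Function.update (Function.update p f₁ 0) f₂ 0) Z hZ0' hagree a₁ w o
    {S | insert a₃ S ∈ 𝓔}
  simp only at hc₁
  have key := zc_a3ow_graph hp hf hends₁' hends₂' hmark' h31 h3o h𝓔 (hZ.trans_eq hc₁)
  simp only at key
  have hc := zc_expr_congr p Z hZ0 hagree a₁ a₃ o 𝓔
  simp only at hc
  exact key.trans_eq hc.symm

end InsertP2

end Summit.Ventures.PercRepro2
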